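import Mathlib

/-!
# LINE-19 stub S1 `HodgePoincareColdBox` (crux `AllWindowsColdBox.BoxHighWindowsSU22`, stmt-QuantumFields-24004 / low item 24335),
# part 1: box sums on `ℤ⁴` — support-controlled reindexing and the one-dimensional Dirichlet Poincaré inequality

Elementary bookkeeping for finitely supported functions on `ℤ⁴ = Fin 4 → ℤ`, summed over the cube
`B(a,b) = Fintype.piFinset (fun _ => Finset.Icc a b)`:
* `sum_eq_sum_of_support` — two finite sums agree when the summand vanishes off their common part;
* `sum_shift_eq` — `Σ_{x ∈ B} f(x + v) = Σ_{x ∈ B} f x` when the support of `f` and its translate by `−v` lie in `B`;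
* `sum_shift_le` — `Σ_{x ∈ B} f(x + v) ≤ Σ_{x ∈ B} f x` for `f ≥ 0` supported in `B` (no margin needed);
* `sq_le_mul_sum_sq_diff` / `poincare_line` — **the discrete Dirichlet Poincaré inequality along one axis**: if `g` vanishes unless
  `1 ≤ x_j ≤ N − 1` (and is supported in `B`), then `Σ_B g² ≤ N² · Σ_B (g(x + e_j) − g(x))²` (telescoping from the far side
  `x + N e_j`, where `g` vanishes, and Cauchy–Schwarz; the sharp constant `4 sin²(π/2N)` is not needed).
Mathlib only.  HONEST LABEL: helper toward ONE registered stub of a critic-PASSed line; no crux, rung or summit is proved;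
the Yang–Mills mass gap is NOT proved by this file.
-/

set_option autoImplicit false

open Finset

namespace Summit.QuantumFields.YangMills.Theorems.AllWindowsColdBoxBoxHighLine.HodgePoincare

/-- Membership in the cube `B(a,b) = [a,b]⁴`. -/
theorem mem_box {a b : ℤ} {x : Fin 4 → ℤ} :
    x ∈ Fintype.piFinset (fun _ : Fin 4 => Finset.Icc a b) ↔ ∀ k, a ≤ x k ∧ x k ≤ b := by
  simp [Fintype.mem_piFinset, Finset.mem_Icc]

/-- Two finite sums of the same function agree if the function vanishes wherever the index sets differ. -/
theorem sum_eq_sum_of_support {α : Type*} [DecidableEq α] {S T : Finset α} {f : α → ℝ}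
    (h : ∀ x, f x ≠ 0 → (x ∈ S ↔ x ∈ T)) : ∑ x ∈ S, f x = ∑ x ∈ T, f x := by
  have hS : ∑ x ∈ S ∩ T, f x = ∑ x ∈ S, f x := by
    refine Finset.sum_subset Finset.inter_subset_left fun x hxS hxn => ?_
    by_contra hne
    exact hxn (Finset.mem_inter.2 ⟨hxS, (h x hne).1 hxS⟩)
  have hT : ∑ x ∈ S ∩ T, f x = ∑ x ∈ T, f x := by
    refine Finset.sum_subset Finset.inter_subset_right fun x hxT hxn => ?_
    by_contra hne
    exact hxn (Finset.mem_inter.2 ⟨(h x hne).2 hxT, hxT⟩)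
  rw [← hS, hT]

/-- **Translation invariance of box sums** for a summand whose support, together with its translate by `−v`, lies in the box. -/
theorem sum_shift_eq {a b : ℤ} (v : Fin 4 → ℤ) (f : (Fin 4 → ℤ) → ℝ)
    (hf : ∀ x, f x ≠ 0 → (∀ k, a ≤ x k ∧ x k ≤ b) ∧ (∀ k, a ≤ x k - v k ∧ x k - v k ≤ b)) :
    ∑ x ∈ Fintype.piFinset (fun _ : Fin 4 => Finset.Icc a b), f (x + v) =
      ∑ x ∈ Fintype.piFinset (fun _ : Fin 4 => Finset.Icc a b), f x := by
  classical
  set B := Fintype.piFinset (fun _ : Fin 4 => Finset.Icc a b) with hB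
  have h1 : ∑ x ∈ B, f (x + v) = ∑ y ∈ B.map (addRightEmbedding v), f y := by
    rw [Finset.sum_map]; rfl
  rw [h1]
  refine sum_eq_sum_of_support fun y hy => ?_
  obtain ⟨hy1, hy2⟩ := hf y hy
  constructor
  · intro _; exact mem_box.2 hy1
  · intro _
    refine Finset.mem_map.2 ⟨y - v, mem_box.2 (fun k => by simpa using hy2 k), ?_⟩
    simp

/-- **Translated box sums of a non-negative summand supported in the box do not exceed the untranslated sum.** -/
theorem sum_shift_le {a b : ℤ} (v : Fin 4 → ℤ) (f : (Fin 4 → ℤ) → ℝ) (hf0 : ∀ x, 0 ≤ f x)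
    (hf : ∀ x, f x ≠ 0 → ∀ k, a ≤ x k ∧ x k ≤ b) :
    ∑ x ∈ Fintype.piFinset (fun _ : Fin 4 => Finset.Icc a b), f (x + v) ≤
      ∑ x ∈ Fintype.piFinset (fun _ : Fin 4 => Finset.Icc a b), f x := by
  classical
  set B := Fintype.piFinset (fun _ : Fin 4 => Finset.Icc a b) with hB
  have h1 : ∑ x ∈ B, f (x + v) = ∑ y ∈ B.map (addRightEmbedding v), f y := by
    rw [Finset.sum_map]; rfl
  rw [h1]
  have h2 : ∑ y ∈ B.map (addRightEmbedding v), f y = ∑ y ∈ B.map (addRightEmbedding v) ∩ B, f y := by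
    refine (Finset.sum_subset Finset.inter_subset_left fun y hyS hyn => ?_).symm
    by_contra hne
    exact hyn (Finset.mem_inter.2 ⟨hyS, mem_box.2 (hf y hne)⟩)
  rw [h2]
  exact Finset.sum_le_sum_of_subset_of_nonneg Finset.inter_subset_right fun y _ _ => hf0 y

/-- Telescoping along the axis `j`: `g(x + N e_j) − g(x) = Σ_{l<N} (g(x + (l+1) e_j) − g(x + l e_j))`. -/
theorem telescope_axis (g : (Fin 4 → ℤ) → ℝ) (x : Fin 4 → ℤ) (j : Fin 4) (N : ℕ) :
    ∑ l ∈ Finset.range N, (g (x + Pi.single j ((l : ℤ) + 1)) - g (x + Pi.single j (l : ℤ))) =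
      g (x + Pi.single j (N : ℤ)) - g x := by
  have := Finset.sum_range_sub (fun l : ℕ => g (x + Pi.single j (l : ℤ))) N
  simp only [Nat.cast_add, Nat.cast_one, Nat.cast_zero] at this
  rw [this, Pi.single_zero, add_zero]

/-- Pointwise step of the Poincaré inequality: if `g` vanishes at `x + N e_j`, then
`g(x)² ≤ N · Σ_{l<N} (g(x + (l+1)e_j) − g(x + l e_j))²` (Cauchy–Schwarz on the telescoping sum). -/
theorem sq_le_mul_sum_sq_diff (g : (Fin 4 → ℤ) → ℝ) (x : Fin 4 → ℤ) (j : Fin 4) (N : ℕ)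
    (hfar : g (x + Pi.single j (N : ℤ)) = 0) :
    g x ^ 2 ≤ (N : ℝ) * ∑ l ∈ Finset.range N, (g (x + Pi.single j ((l : ℤ) + 1)) - g (x + Pi.single j (l : ℤ))) ^ 2 := by
  have htel := telescope_axis g x j N
  rw [hfar, zero_sub] at htel
  have hg : g x = - ∑ l ∈ Finset.range N, (g (x + Pi.single j ((l : ℤ) + 1)) - g (x + Pi.single j (l : ℤ))) := by
    linarith
  have hcs := sq_sum_le_card_mul_sum_sq (s := Finset.range N)
    (f := fun l => g (x + Pi.single j ((l : ℤ) + 1)) - g (x + Pi.single j (l : ℤ)))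
  rw [Finset.card_range] at hcs
  rw [hg, neg_sq]
  exact hcs

/-- Support of the squared forward difference of a function supported in a box, in the direction `j`. -/
theorem diff_sq_support {a b : ℤ} (ha : a ≤ 0) (N : ℕ) (j : Fin 4) (g : (Fin 4 → ℤ) → ℝ)
    (hg : ∀ x, g x ≠ 0 → (∀ k, a ≤ x k ∧ x k ≤ b) ∧ 1 ≤ x j ∧ x j + 1 ≤ N) (x : Fin 4 → ℤ)
    (hx : (g (x + Pi.single j 1) - g x) ^ 2 ≠ 0) : ∀ k, a ≤ x k ∧ x k ≤ b := by
  intro k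
  have hne : g (x + Pi.single j 1) - g x ≠ 0 := fun h => hx (by rw [h]; ring)
  by_cases h1 : g x = 0
  · rw [h1, sub_zero] at hne
    obtain ⟨hb1, hb2, -⟩ := hg _ hne
    have hk := hb1 k
    by_cases hkj : k = j
    · subst hkj
      simp only [Pi.add_apply, Pi.single_eq_same] at hk hb2
      constructor <;> omega
    · rw [Pi.add_apply, Pi.single_eq_of_ne hkj, add_zero] at hk
      exact hk
  · exact (hg x h1).1 k

/-- **Discrete Dirichlet Poincaré inequality along one axis.**  If `g` is supported in the cube `[a,b]⁴` and vanishes unless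
`1 ≤ x_j ≤ N − 1`, then `Σ_B g² ≤ N² · Σ_B (g(x + e_j) − g(x))²`. -/
theorem poincare_line {a b : ℤ} (ha : a ≤ 0) (N : ℕ) (j : Fin 4) (g : (Fin 4 → ℤ) → ℝ)
    (hg : ∀ x, g x ≠ 0 → (∀ k, a ≤ x k ∧ x k ≤ b) ∧ 1 ≤ x j ∧ x j + 1 ≤ N) :
    ∑ x ∈ Fintype.piFinset (fun _ : Fin 4 => Finset.Icc a b), g x ^ 2 ≤
      (N : ℝ) ^ 2 * ∑ x ∈ Fintype.piFinset (fun _ : Fin 4 => Finset.Icc a b), (g (x + Pi.single j 1) - g x) ^ 2 := by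
  -- pointwise: g(x)² ≤ N Σ_{l<N} d(x + l e_j)
  have hpt : ∀ x, g x ^ 2 ≤ (N : ℝ) * ∑ l ∈ Finset.range N,
      (g (x + Pi.single j (l : ℤ) + Pi.single j 1) - g (x + Pi.single j (l : ℤ))) ^ 2 := by
    intro x
    by_cases hx : g x = 0
    · rw [hx, zero_pow two_ne_zero]
      exact mul_nonneg (Nat.cast_nonneg N) (Finset.sum_nonneg fun l _ => sq_nonneg _)
    · have hfar : g (x + Pi.single j (N : ℤ)) = 0 := by
        by_contra hne
        have h1 : (x + Pi.single j (N : ℤ) : Fin 4 → ℤ) j + 1 ≤ N := (hg _ hne).2.2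
        have h2 : 1 ≤ x j := (hg x hx).2.1
        simp only [Pi.add_apply, Pi.single_eq_same] at h1
        omega
      refine (sq_le_mul_sum_sq_diff g x j N hfar).trans (le_of_eq ?_)
      congr 1
      refine Finset.sum_congr rfl fun l _ => ?_
      rw [add_assoc, ← Pi.single_add]
  have hd0 : ∀ x, 0 ≤ (g (x + Pi.single j 1) - g x) ^ 2 := fun x => sq_nonneg _
  calc ∑ x ∈ Fintype.piFinset (fun _ : Fin 4 => Finset.Icc a b), g x ^ 2
      ≤ ∑ x ∈ Fintype.piFinset (fun _ : Fin 4 => Finset.Icc a b), (N : ℝ) * ∑ l ∈ Finset.range N,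
          (g (x + Pi.single j (l : ℤ) + Pi.single j 1) - g (x + Pi.single j (l : ℤ))) ^ 2 :=
        by
          refine Finset.sum_le_sum ?_
          intro x _
          exact hpt x
    _ = (N : ℝ) * ∑ l ∈ Finset.range N, ∑ x ∈ Fintype.piFinset (fun _ : Fin 4 => Finset.Icc a b),
          (g (x + Pi.single j (l : ℤ) + Pi.single j 1) - g (x + Pi.single j (l : ℤ))) ^ 2 := by
        rw [← Finset.mul_sum, Finset.sum_comm]
    _ ≤ (N : ℝ) * ∑ l ∈ Finset.range N, ∑ x ∈ Fintype.piFinset (fun _ : Fin 4 => Finset.Icc a b),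
          (g (x + Pi.single j 1) - g x) ^ 2 := by
        refine mul_le_mul_of_nonneg_left (Finset.sum_le_sum fun l _ => ?_) (Nat.cast_nonneg N)
        exact sum_shift_le (Pi.single j (l : ℤ)) (fun x => (g (x + Pi.single j 1) - g x) ^ 2) hd0
          (diff_sq_support ha N j g hg)
    _ = (N : ℝ) ^ 2 * ∑ x ∈ Fintype.piFinset (fun _ : Fin 4 => Finset.Icc a b), (g (x + Pi.single j 1) - g x) ^ 2 := by
        rw [Finset.sum_const, Finset.card_range, nsmul_eq_mul]; ring

end Summit.QuantumFields.YangMills.Theorems.AllWindowsColdBoxBoxHighLine.HodgePoincare
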